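import Summits.CriticalPhenomena.PercolationContinuityZ3.Theorems.Transplant.PlanarCellsPSep2
import Summits.CriticalPhenomena.PercolationContinuityZ3.Theorems.Transplant.PlanarCellsSepQ
import Summits.CriticalPhenomena.PercolationContinuityZ3.Theorems.Transplant.PlanarCellsFaces
import HarnessLib

/-!
# Planar `ℤ²`-separation of the OFF-LINEAGE regions from the world of a probe `v → x → y` (`x = v + δ`, `y = x + du`, `du ≠ rev δ`):
# the cubes `Q u`, between-boxes `Btw w δ'` and stubs `Stub u du' j` of macro-vertices off the lineage are disjoint from and not adjacent to
# `W(v, δ, du) = Btw v δ ∪ Q x ∪ Hfull x du` — the planar input `hSQ / hSB / hSS` of refuter p5-g3's `deep_of_run` (run-restricted corridor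
# excess, design (D))

builds on p205010 (kernel theorem, internal audit signed; external expert review pending) — nothing in this file uses p205010.
Lane `prim-bschramm`, seat `prim-bschramm-p3` (lead order (3) of 2026-08-20T15:15Z); helper file (`--supports stmt-CriticalPhenomena-4575 --as helper`).

All three follow from the separation of CELLS and ZONES from cubes and far boxes (`Cell_sep_Q`, `Zone_sep_Q`, `Cell_sep_Efar`,
`Zone_sep_Efar`, `Btw_sep_Efar`) through the containments `Q u ⊆ Cell u`, `Btw w δ' ⊆ Cell w ∪ Cell (w + δ')`,
`Stub u du' j ⊆ Cell u ∪ Zone u du'` (`j < K`), `Btw v δ ∪ Q (v + δ) ⊆ Efar v δ`, `Hfull x du ⊆ Q x ∪ Efar x du`.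
* `probeWorld C v δ du := C.Btw v δ ∪ C.Q (v + stepVec δ) ∪ C.Hfull (v + stepVec δ) du`;
* `Btw_subset_Efar`, `mem_Efar_of_mem_Q_add`, `Cell_sep_probeWorld`, `Zone_sep_probeWorld`;
* **`Q_sep_probeWorld`** (`hSQ`), **`Btw_sep_probeWorld`** (`hSB`), **`Stub_sep_probeWorld`** (`hSS`).
[cite: KozmaNitzan2024, §4 p. 26 ((29)), p. 31 ((31))]
-/

noncomputable section

namespace Summit.CriticalPhenomena.PercolationContinuityZ3.Theorems

namespace Transplant

open Literature.Probability.Percolation Literature.Probability.LatticeModels SimpleGraph GadgetSystem Contour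
open Literature.Probability.Percolation.KozmaNitzan
open Literature.Probability.Percolation.KozmaNitzan.Cells (oth oth_ne sgOf sgOf_sign stepVec_apply_fst stepVec_apply_oth eq_oth_of_ne oth_oth)

namespace PCells

variable (C : PCells)

/-- **The planar world of the probe `v → v+δ → v+δ+du`**: the between-box, the target cube and its corridor.
[cite: KozmaNitzan2024, §4 p. 26 (E_{v,x}, H_{x,y})] -/
def probeWorld (v : Site 2) (δ du : MDir) : Finset (Site 2) := C.Btw v δ ∪ C.Q (v + stepVec δ) ∪ C.Hfull (v + stepVec δ) du

/-- `Btw v δ ⊆ Efar v δ`. [folklore] -/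
theorem Btw_subset_Efar (v : Site 2) (δ : MDir) : C.Btw v δ ⊆ C.Efar v δ :=
  sBox_mono (sgOf_sign δ) _ le_rfl (by have := C.one_le_r; omega) le_rfl

/-- A site of `Q (v + δ)` lies in `Efar v δ` (membership form of `Q (v + δ) ⊆ Efar v δ` for these planar cells). [folklore] -/
theorem mem_Efar_of_mem_Q_add {v : Site 2} {δ : MDir} {t : Site 2} (ht : t ∈ C.Q (v + stepVec δ)) : t ∈ C.Efar v δ := by
  rw [Q, C.mem_sq_iff] at ht
  rw [Efar, mem_psBox_iff]
  have h1 := ht δ.1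
  have h2 := ht (oth δ.1)
  rw [C.cen_add_stepVec_fst] at h1
  rw [C.cen_add_stepVec_oth] at h2
  push_cast at h1 h2 ⊢
  refine ⟨?_, h2⟩
  rcases sgOf_sign δ with hs | hs <;> rw [hs] at h1 ⊢ <;> constructor <;> nlinarith [h1.1, h1.2, C.one_le_r]

/-- The probe world lies in `Efar v δ ∪ Q x ∪ Efar x du` (`x = v + δ`). [folklore] -/
theorem probeWorld_subset (v : Site 2) (δ du : MDir) :
    (↑(C.probeWorld v δ du) : Set (Site 2)) ⊆ ↑(C.Efar v δ) ∪ (↑(C.Q (v + stepVec δ)) ∪ ↑(C.Efar (v + stepVec δ) du)) := by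
  intro t ht
  rw [Finset.mem_coe, probeWorld] at ht
  rcases Finset.mem_union.1 ht with ht | ht
  · rcases Finset.mem_union.1 ht with ht | ht
    · exact Or.inl (Finset.mem_coe.2 (C.Btw_subset_Efar v δ ht))
    · exact Or.inr (Or.inl (Finset.mem_coe.2 ht))
  · rcases Finset.mem_union.1 (C.Hfull_subset_Q_union_Efar _ du ht) with h' | h'
    · exact Or.inr (Or.inl (Finset.mem_coe.2 h'))
    · exact Or.inr (Or.inr (Finset.mem_coe.2 h'))

/-- Separation from a union on the right. [folklore] -/
theorem sep_union_right {A B B' : Set (Site 2)} (h : KozmaNitzan.Sep A B) (h' : KozmaNitzan.Sep A B') : KozmaNitzan.Sep A (B ∪ B') := by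
  rintro y hy z (hz | hz)
  · exact h y hy z hz
  · exact h' y hy z hz

/-- **A cell off the lineage is separated from the probe world** (`u ∉ {v, x, y}`). [cite: KozmaNitzan2024, §4 p. 31] -/
theorem Cell_sep_probeWorld {v u : Site 2} {δ du : MDir} (huv : u ≠ v) (hux : u ≠ v + stepVec δ) (huy : u ≠ v + stepVec δ + stepVec du) :
    KozmaNitzan.Sep (↑(C.Cell u) : Set (Site 2)) ↑(C.probeWorld v δ du) :=
  (sep_union_right (C.Cell_sep_Efar huv hux) (sep_union_right (C.Cell_sep_Q hux) (C.Cell_sep_Efar hux huy))).mono le_rfl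
    (C.probeWorld_subset v δ du)

/-- **A stub zone off the lineage is separated from the probe world** (`u ∉ {v, x, y}`). [cite: KozmaNitzan2024, §4 p. 31] -/
theorem Zone_sep_probeWorld {v u : Site 2} {δ du : MDir} (huv : u ≠ v) (hux : u ≠ v + stepVec δ) (huy : u ≠ v + stepVec δ + stepVec du)
    (δ' : MDir) : KozmaNitzan.Sep (↑(C.Zone u δ') : Set (Site 2)) ↑(C.probeWorld v δ du) :=
  (sep_union_right (C.Zone_sep_Efar huv hux δ') (sep_union_right (C.Zone_sep_Q u δ' _) (C.Zone_sep_Efar hux huy δ'))).mono le_rfl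
    (C.probeWorld_subset v δ du)

/-- **`hSQ`: cubes off the lineage are separated from the probe world.** [cite: KozmaNitzan2024, §4 p. 26 ((29))] -/
theorem Q_sep_probeWorld (v : Site 2) (δ du : MDir) (u : Site 2) (_hvy : v + stepVec δ + stepVec du ≠ v) (huv : u ≠ v)
    (hux : u ≠ v + stepVec δ) (huy : u ≠ v + stepVec δ + stepVec du) :
    KozmaNitzan.Sep (↑(C.Q u) : Set (Site 2)) ↑(C.probeWorld v δ du) :=
  (C.Cell_sep_probeWorld huv hux huy).mono (Finset.coe_subset.2 (C.Q_subset_Cell u)) le_rfl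

/-- **`hSB`: between-boxes off the lineage are separated from the probe world** (`w ∉ {x, y}`, `w + δ' ∉ {v, x, y}`; the sibling boxes of
`v` itself are covered: they meet `Efar v δ` only beyond `ℓ¹`-distance `2`). [cite: KozmaNitzan2024, §4 p. 31 ((31))] -/
theorem Btw_sep_probeWorld (v : Site 2) (δ du : MDir) (w : Site 2) (δ' : MDir) (_hvy : v + stepVec δ + stepVec du ≠ v)
    (hwx : w ≠ v + stepVec δ) (hwy : w ≠ v + stepVec δ + stepVec du) (hw'v : w + stepVec δ' ≠ v) (hw'x : w + stepVec δ' ≠ v + stepVec δ)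
    (hw'y : w + stepVec δ' ≠ v + stepVec δ + stepVec du) :
    KozmaNitzan.Sep (↑(C.Btw w δ') : Set (Site 2)) ↑(C.probeWorld v δ du) := by
  by_cases hwv : w = v
  · subst hwv
    have hδ : δ' ≠ δ := fun h => hw'x (by rw [h])
    -- the sibling box: separated from `Efar w δ ⊇ Btw w δ ∪ Q x`, and (inside `Cell w ∪ Cell (w + δ')`) from `Efar x du`
    refine KozmaNitzan.Sep.mono ?_ le_rfl (C.probeWorld_subset w δ du)
    refine sep_union_right (C.Btw_sep_Efar w hδ) (sep_union_right ((C.Btw_sep_Efar w hδ).mono le_rfl ?_) ?_)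
    · exact fun t ht => Finset.mem_coe.2 (C.mem_Efar_of_mem_Q_add (Finset.mem_coe.1 ht))
    · refine KozmaNitzan.Sep.mono ?_ (Finset.coe_subset.2 (C.Btw_subset_Cells w δ')) le_rfl
      rw [Finset.coe_union]
      refine KozmaNitzan.Sep.union_left (C.Cell_sep_Efar (Ne.symm ?_) (Ne.symm ?_)) (C.Cell_sep_Efar hw'x hw'y)
      · intro h; exact hwx h.symm
      · intro h; exact hwy h.symm
  · refine KozmaNitzan.Sep.mono ?_ (Finset.coe_subset.2 (C.Btw_subset_Cells w δ')) le_rfl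
    rw [Finset.coe_union]
    exact KozmaNitzan.Sep.union_left (C.Cell_sep_probeWorld hwv hwx hwy) (C.Cell_sep_probeWorld hw'v hw'x hw'y)

/-- **`hSS`: stubs off the lineage are separated from the probe world** (`u ∉ {v, x, y}`, `j + 1 ≤ K`). [cite: KozmaNitzan2024, §4 p. 31] -/
theorem Stub_sep_probeWorld (v : Site 2) (δ du : MDir) (u : Site 2) (du' : MDir) (j : ℕ) (_hvy : v + stepVec δ + stepVec du ≠ v)
    (huv : u ≠ v) (hux : u ≠ v + stepVec δ) (huy : u ≠ v + stepVec δ + stepVec du) (hj : j + 1 ≤ C.K) :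
    KozmaNitzan.Sep (↑(C.Stub u du' j) : Set (Site 2)) ↑(C.probeWorld v δ du) := by
  refine KozmaNitzan.Sep.mono ?_ (Finset.coe_subset.2 (C.Stub_subset_Cell_union_Zone u du' (by omega))) le_rfl
  rw [Finset.coe_union]
  exact KozmaNitzan.Sep.union_left (C.Cell_sep_probeWorld huv hux huy) (C.Zone_sep_probeWorld huv hux huy du')

end PCells

end Transplant

end Summit.CriticalPhenomena.PercolationContinuityZ3.Theorems

end
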